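import Mathlib.Analysis.Calculus.Deriv.Polynomial
import Mathlib.Algebra.Polynomial.BigOperators
import Summits.NavierStokesRegularity.FluidComputer.RowDefect
import Summits.NavierStokesRegularity.FluidComputer.BernsteinEnclosure
import HarnessLib

/-!
# Soundness of the reference-defect bound: `|x̂_i'(u) − F_i(x̂(u))| ≤ DB_i / 2^P` on `[0, H]`
# (`kgen19.defect_bound`; `pub-fluidc-bp3/R1-DESIGN.md` §9.2 `hDB`, layer B of `structure Row`)

HONEST FRAMING (cell `pub-fluidc`, blueprint seat bp3, gen 20): low prior, high value-of-information
experiment on Tao's machine paradigm; NOT a claim that NS blows up. Polynomial algebra over `ℝ[X]`.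

The row's reference `x̂` is given by exact rational coefficient lists `CQ a`
(`RowCheck.RowData.CQ`):
`x̂_a(u) = (toPoly (CQ a)).eval u`, `x̂_a' = (toPoly (CQ a))'.eval u` (`hasDerivAt_xh`). The
defect polynomial
`defectPoly i = (toPoly (CQ i))' − Σ_τ C c_τ · toPoly (CQ j_τ) · toPoly (CQ k_τ)` evaluates to
`x̂_i' − F_i(x̂)` (`eval_defectPoly`, from `ChainField.Fsum_eq` and `Term.coef = Term.coefQ` for
rational
couplings) and has coefficients `defectQ i m` (`coeff_defectPoly`: `coeff_derivative`, `coeff_mul`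
over the
antidiagonal = `polyCoeff`) and degree `≤ 2·DEG` when every list has length `≤ DEG + 1`; the
Bernstein enclosure
`BernsteinEnclosure.abs_poly_le_on_Icc` with `M = bernMax` (its coefficients are the casts of
`bernQ`) and
`bernMax ≤ ⌈bernMax·2^P⌉ / 2^P = DB_i / 2^P` give the **main theorem** `abs_defect_le`. This
discharges the
hypothesis `Cert.hDB` of the row model for the reference the table layer builds from `CQ`.

[cite: Tao2016AveragedNS, §5.5 Thm 5.3 (5.5)]
-/

namespace Summit.NavierStokesRegularity.FluidComputer

namespace ChainField

open Polynomial Finset Set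
open Literature.Analysis.FluidPDE.FluidComputer (GateData)

/-! ### List bookkeeping -/

/-- A `List.range` sum is the `Finset.range` sum. [folklore] -/
theorem sum_map_range {M : Type*} [AddCommMonoid M] (n : ℕ) (f : ℕ → M) :
    ((List.range n).map f).sum = ∑ m ∈ Finset.range n, f m := by
  rw [Finset.sum_eq_multiset_sum, Finset.range_val, ← Multiset.coe_range, Multiset.map_coe,
    Multiset.sum_coe]

/-- Every member of a list is below its `foldl max`. [folklore] -/
theorem le_foldl_max {l : List ℚ} {x : ℚ} (b : ℚ) (h : x ∈ l ∨ x ≤ b) : x ≤ l.foldl max b := by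
  induction l generalizing b with
  | nil =>
    rcases h with h | h
    · simp at h
    · simpa using h
  | cons a t ih =>
    simp only [List.foldl_cons]
    rcases h with h | h
    · rcases List.mem_cons.1 h with rfl | h
      · exact ih _ (Or.inr (le_max_right _ _))
      · exact ih _ (Or.inl h)
    · exact ih _ (Or.inr (h.trans (le_max_left _ _)))

/-! ### The reference polynomial of a coefficient list -/

/-- `toPoly l = Σ_{m < |l|} l_m X^m` over `ℝ`. [folklore] -/
noncomputable def toPoly (l : List ℚ) : ℝ[X] :=
  ∑ m ∈ Finset.range l.length, C ((l.getD m 0 : ℚ) : ℝ) * X ^ m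

/-- Its coefficients are the list entries (zero beyond the length). [folklore] -/
theorem coeff_toPoly (l : List ℚ) (m : ℕ) : (toPoly l).coeff m = ((l.getD m 0 : ℚ) : ℝ) := by
  simp only [toPoly, finsetSum_coeff, coeff_C_mul_X_pow]
  rw [Finset.sum_ite_eq]
  split_ifs with h
  · rfl
  · rw [Finset.mem_range, not_lt] at h
    rw [List.getD_eq_default _ _ h]
    simp

/-- Degree bound. [folklore] -/
theorem natDegree_toPoly_le {l : List ℚ} {D : ℕ} (hl : l.length ≤ D + 1) :
    (toPoly l).natDegree ≤ D := by
  rw [natDegree_le_iff_degree_le, toPoly]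
  refine (degree_sum_le _ _).trans (Finset.sup_le fun m hm => (degree_C_mul_X_pow_le m _).trans ?_)
  have : m ≤ D := by rw [Finset.mem_range] at hm; omega
  exact_mod_cast this

/-- The reference of coordinate `a` at local time `u`: `x̂_a(u)`. [folklore] -/
noncomputable def xh (CQ : Fin 9 → List ℚ) (u : ℝ) (a : Fin 9) : ℝ := (toPoly (CQ a)).eval u

/-- Its derivative `x̂_a'(u)`. [folklore] -/
noncomputable def xhd (CQ : Fin 9 → List ℚ) (u : ℝ) (a : Fin 9) : ℝ :=
  (derivative (toPoly (CQ a))).eval u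

/-- `x̂_a` is differentiable with derivative `x̂_a'`. [folklore] -/
theorem hasDerivAt_xh (CQ : Fin 9 → List ℚ) (a : Fin 9) (u : ℝ) :
    HasDerivAt (fun v => xh CQ v a) (xhd CQ u a) u :=
  (toPoly (CQ a)).hasDerivAt u

/-- `x̂_a(u)` as the explicit sum `Σ_m CQ_{a,m} u^m`. [folklore] -/
theorem xh_eq_sum (CQ : Fin 9 → List ℚ) (u : ℝ) (a : Fin 9) :
    xh CQ u a = ∑ m ∈ Finset.range (CQ a).length, (((CQ a).getD m 0 : ℚ) : ℝ) * u ^ m := by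
  simp [xh, toPoly, eval_finsetSum]

/-! ### The defect polynomial -/

/-- `defectPoly i = (x̂_i)' − Σ_τ c_τ · x̂_{j_τ} x̂_{k_τ}` as a polynomial. [folklore] -/
noncomputable def defectPoly (qU qD : Fin 6 → ℚ) (CQ : Fin 9 → List ℚ) (i : Fin 9) : ℝ[X] :=
  derivative (toPoly (CQ i)) -
    ((terms i).map fun τ => C ((τ.coefQ qU qD : ℚ) : ℝ) * (toPoly (CQ τ.j) * toPoly (CQ τ.k))).sum

/-- For rational couplings the real term coefficient is the cast of the exact one. [folklore] -/
theorem coef_eq_coefQ {g : GateData} {Λ : ℝ} {qU qD : Fin 6 → ℚ} (hU : ∀ c, gsel g c = qU c)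
    (hD : ∀ c, Λ * gsel g c = qD c) (τ : Term) : τ.coef g Λ = ((τ.coefQ qU qD : ℚ) : ℝ) := by
  have hD' : ∀ c, Λ * (qU c : ℝ) = qD c := fun c => by rw [← hU]; exact hD c
  rcases τ with ⟨dn, c, sgn, j, k⟩
  cases sgn <;> cases dn <;> simp [Term.coef, Term.coefQ, hU, hD']

/-- The defect polynomial evaluates to `x̂_i' − F_i(x̂)`. [folklore] -/
theorem eval_defectPoly {g : GateData} {Λ : ℝ} {qU qD : Fin 6 → ℚ} (hU : ∀ c, gsel g c = qU c)
    (hD : ∀ c, Λ * gsel g c = qD c) (CQ : Fin 9 → List ℚ) (i : Fin 9) (u : ℝ) :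
    (defectPoly qU qD CQ i).eval u = xhd CQ u i - F g Λ (xh CQ u) i := by
  have hF := congrFun (Fsum_eq g Λ (xh CQ u)) i
  rw [← hF]
  simp only [defectPoly, eval_sub, xhd, eval_listSum, List.map_map, Fsum]
  congr 2
  exact List.map_congr_left fun τ _ => by simp [Function.comp, xh, coef_eq_coefQ hU hD, eval_mul]

/-- The product coefficient over the antidiagonal as a range sum (`polyCoeff`). [folklore] -/
theorem sum_antidiagonal_getD (p q : List ℚ) (m : ℕ) :
    ∑ x ∈ antidiagonal m, ((p.getD x.1 0 : ℚ) : ℝ) * ((q.getD x.2 0 : ℚ) : ℝ) =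
      ∑ i ∈ Finset.range (m + 1), ((p.getD i 0 : ℚ) : ℝ) * ((q.getD (m - i) 0 : ℚ) : ℝ) :=
  Finset.Nat.sum_antidiagonal_eq_sum_range_succ
    (fun a b => ((p.getD a 0 : ℚ) : ℝ) * ((q.getD b 0 : ℚ) : ℝ)) m

/-- Its coefficients are the exact `defectQ`. [folklore] -/
theorem coeff_defectPoly (qU qD : Fin 6 → ℚ) (CQ : Fin 9 → List ℚ) (i : Fin 9) (m : ℕ) :
    (defectPoly qU qD CQ i).coeff m = ((defectQ qU qD CQ i m : ℚ) : ℝ) := by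
  simp only [defectPoly, coeff_sub, coeff_derivative, coeff_toPoly, coeff_list_sum_map, coeff_C_mul]
  simp only [coeff_mul, coeff_toPoly, sum_antidiagonal_getD, defectQ, polyCoeff, sum_map_range]
  rw [Rat.cast_sub, Rat.cast_list_sum, List.map_map]
  congr 1
  · push_cast; ring
  · congr 1
    exact List.map_congr_left fun τ _ => by simp only [Function.comp_apply]; push_cast; rfl

/-- Degree of the defect polynomial. [folklore] -/
theorem natDegree_defectPoly_le {qU qD : Fin 6 → ℚ} {CQ : Fin 9 → List ℚ} {DEG : ℕ}
    (hlen : ∀ a, (CQ a).length ≤ DEG + 1) (i : Fin 9) :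
    (defectPoly qU qD CQ i).natDegree ≤ 2 * DEG := by
  have hP : ∀ a, (toPoly (CQ a)).natDegree ≤ DEG := fun a => natDegree_toPoly_le (hlen a)
  refine (natDegree_sub_le _ _).trans (max_le ?_ ?_)
  · exact ((natDegree_derivative_le _).trans (Nat.sub_le _ _)).trans ((hP i).trans (by omega))
  · -- (`foldr max 0 ≤ N`, inlined: the named lemma lives in an unrelated Literature file)
    have hfold : ∀ (l : List ℕ) (N : ℕ), (∀ x ∈ l, x ≤ N) → l.foldr max 0 ≤ N := by
      intro l N h
      induction l with
      | nil => simp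
      | cons a t ih =>
        simp only [List.foldr_cons]
        exact max_le (h a (by simp)) (ih fun x hx => h x (by simp [hx]))
    refine (natDegree_list_sum_le _).trans (hfold _ _ fun x hx => ?_)
    simp only [List.map_map, List.mem_map, Function.comp] at hx
    obtain ⟨τ, -, rfl⟩ := hx
    refine (natDegree_C_mul_le _ _).trans (natDegree_mul_le.trans ?_)
    have := hP τ.j; have := hP τ.k; omega

/-- The defect as the explicit sum `Σ_{m ≤ 2DEG} defectQ_m u^m`. [folklore] -/
theorem defect_eq_sum {g : GateData} {Λ : ℝ} {qU qD : Fin 6 → ℚ} (hU : ∀ c, gsel g c = qU c)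
    (hD : ∀ c, Λ * gsel g c = qD c) {CQ : Fin 9 → List ℚ} {DEG : ℕ}
    (hlen : ∀ a, (CQ a).length ≤ DEG + 1) (i : Fin 9) (u : ℝ) :
    xhd CQ u i - F g Λ (xh CQ u) i =
      ∑ m ∈ Finset.range (2 * DEG + 1), ((defectQ qU qD CQ i m : ℚ) : ℝ) * u ^ m := by
  rw [← eval_defectPoly hU hD,
    eval_eq_sum_range' (lt_of_le_of_lt (natDegree_defectPoly_le hlen i) (Nat.lt_succ_self _))]
  simp only [coeff_defectPoly]

/-! ### The Bernstein bound -/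

/-- The exact Bernstein coefficients are the casts of `BernsteinEnclosure.coeff`. [folklore] -/
theorem bernQ_cast (n : ℕ) (dt : ℕ → ℚ) (j : ℕ) :
    ((bernQ n dt j : ℚ) : ℝ) = BernsteinEnclosure.coeff n (fun m => (dt m : ℝ)) j := by
  simp only [bernQ, BernsteinEnclosure.coeff, sum_map_range]
  push_cast
  rfl

/-- Every Bernstein coefficient is below `bernMax` in absolute value. [folklore] -/
theorem abs_bernQ_le_bernMax (n : ℕ) (H : ℚ) (d : ℕ → ℚ) {j : ℕ} (hj : j ≤ n) :
    |bernQ n (fun m => d m * H ^ m) j| ≤ bernMax n H d := by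
  unfold bernMax
  exact le_foldl_max 0 (Or.inl (List.mem_map.2 ⟨j, List.mem_range.2 (Nat.lt_succ_of_le hj), rfl⟩))

/-- **Soundness of the kernel's defect bound** (`Cert.hDB`): on `[0, H]`,
`|x̂_i'(u) − F_i(x̂(u))| ≤ DB_i / 2^P` with `DB_i = defectBound P DEG qU qD H CQ i`, for a chain
field whose
couplings are the rationals `qU` (upstream) and `qD = Λ·` upstream (downstream) and reference
lists of
length `≤ DEG + 1`. [cite: Tao2016AveragedNS, §5.5 Thm 5.3 (5.5)] -/
theorem abs_defect_le {g : GateData} {Λ : ℝ} {qU qD : Fin 6 → ℚ} (hU : ∀ c, gsel g c = qU c)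
    (hD : ∀ c, Λ * gsel g c = qD c) {CQ : Fin 9 → List ℚ} {DEG : ℕ}
    (hlen : ∀ a, (CQ a).length ≤ DEG + 1) (P : ℕ) {H : ℚ} (hH : 0 < (H : ℝ)) {u : ℝ}
    (hu : u ∈ Icc 0 (H : ℝ)) (i : Fin 9) :
    |xhd CQ u i - F g Λ (xh CQ u) i| ≤ (defectBound P DEG qU qD H CQ i : ℝ) / 2 ^ P := by
  rw [defect_eq_sum hU hD hlen]
  have hB := BernsteinEnclosure.abs_poly_le_on_Icc (n := 2 * DEG)
    (d := fun m => ((defectQ qU qD CQ i m : ℚ) : ℝ))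
    (M := ((bernMax (2 * DEG) H (defectQ qU qD CQ i) : ℚ) : ℝ)) hH ?_ hu
  · refine hB.trans ?_
    rw [le_div_iff₀ (by positivity), defectBound]
    exact_mod_cast Int.le_ceil (bernMax (2 * DEG) H (defectQ qU qD CQ i) * 2 ^ P)
  · intro j hj
    have h1 : BernsteinEnclosure.coeff (2 * DEG)
        (fun m => ((defectQ qU qD CQ i m : ℚ) : ℝ) * (H : ℝ) ^ m) j =
        ((bernQ (2 * DEG) (fun m => defectQ qU qD CQ i m * H ^ m) j : ℚ) : ℝ) := by
      rw [bernQ_cast]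
      congr 1
      funext m
      push_cast
      rfl
    rw [h1]
    exact_mod_cast abs_bernQ_le_bernMax (2 * DEG) H _ hj

end ChainField

end Summit.NavierStokesRegularity.FluidComputer
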